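import Summits.NavierStokesRegularity.NavierStokesRegularity.Theorems.SoloRefuteZeroual2026BGW
import Literature.Analysis.FluidPDE.LeraySelfSimilarCalculus
import HarnessLib

/-!
# C157 `Zeroual2026` — records-grade kernel object: `¬ Step7_BGW510 K` for every `K`
(the (5.10) Brezis–Gallouet display is beaten by dilation despite its logarithm)

`Literature.Claims.NS.Zeroual2026.Step7_BGW510 K` types (5.10)–(5.11) p.9 l.44–58: for every `C²` field
`w` on `ℝ³` with `w, ∇w, Δw ∈ L²`, `‖w‖²_{H¹} > 0` and `w` bounded,
`|w(x)| ≤ C_BGW ‖w‖_{H¹} √(log(e + ‖w‖_{H²-type}/‖w‖_{H¹}))` at every point (`‖w‖²_{H¹} = h1Sq w`,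
`‖w‖²_{H²-type} = h1Sq w + stokesSq w`). Typist's flag: the two-dimensional Brezis–Gallouet form written
in 3-D. The amplitude ray does not separate the two sides here (both have degree `1`), but the spatial
CONCENTRATION `U_b = U(b·)` of the landed Ramm test field does, logarithm notwithstanding: the left side at
the moving point `b⁻¹x₀` is the fixed number `|U(x₀)| > 0`, while `h1Sq U_b = b⁻³‖U‖² + b⁻¹‖∇U‖² ≤ b⁻¹(…)`,
`stokesSq U_b = b‖ΔU‖²`, so the logarithm is `≤ log(e + 1 + b√(‖ΔU‖²/‖∇U‖²)) ≤ 2√((e+1+√…)·b)` and the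
squared right side is `O(b⁻¹·√b) = O(b^{-1/2}) → 0`.

Main results (namespace `Summit.NavierStokesRegularity.NavierStokesRegularity.Theorems.Zeroual2026`, the
C157 kits'; all names new): `l2Sq_eq_integral'`, `lintegral_enorm_sq_lt_top'` (any codomain), `fderiv_fam`,
`l2Sq_fderiv_fam`, `h1Sq_fam_one`, `integral_sq_fderiv_testDatum_pos`,
`not_Step7_BGW510 : ∀ K, ¬ Step7_BGW510 K`.

WHAT THIS IS NOT: not a claim about NS regularity or blow-up; not a claim about any author beyond the
typed locator [cite: Zeroual2026, (5.10)–(5.11) p.9 l.44–58]. `Step7_BGW510` is an unconsumed SUPPORT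
binder of the skeleton (ADJUDICATED #140 is located elsewhere); records-grade only.
-/

noncomputable section

set_option linter.dupNamespace false

open MeasureTheory Set Filter Function Metric
open scoped Topology ENNReal ContDiff Laplacian

namespace Summit.NavierStokesRegularity.NavierStokesRegularity.Theorems.Zeroual2026

open Literature.Analysis.FluidPDE Literature.Claims.NS.Zeroual2026
open Summit.NavierStokesRegularity.NavierStokesRegularity.Theorems.Ramm2024 (testDatum contDiff_testDatum
  hasCompactSupport_testDatum testDatum_ne_zero)

/-! ## `L²` bookkeeping for continuous compactly supported maps into any normed group -/

/-- The skeleton's `l2Sq` (via `∫⁻`) is the Bochner integral `∫ ‖g‖²` for a continuous map (any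
codomain; the landed `l2Sq_eq_integral` is the field-valued case). [folklore] -/
theorem l2Sq_eq_integral' {F : Type*} [NormedAddCommGroup F] {g : E3 → F} (hg : Continuous g) :
    l2Sq g = ∫ x, ‖g x‖ ^ 2 := by
  unfold l2Sq
  rw [integral_eq_lintegral_of_nonneg_ae (Eventually.of_forall fun x => sq_nonneg _)
    ((hg.norm.pow 2).aestronglyMeasurable)]
  congr 1
  refine lintegral_congr fun x => ?_
  rw [← ofReal_norm, ENNReal.ofReal_pow (norm_nonneg _)]

/-- `∫⁻ ‖g‖ₑ² < ∞` for a continuous compactly supported map (any codomain). [folklore] -/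
theorem lintegral_enorm_sq_lt_top' {F : Type*} [NormedAddCommGroup F] {g : E3 → F} (hg : Continuous g)
    (hc : HasCompactSupport g) : (∫⁻ x, ‖g x‖ₑ ^ 2) < ⊤ := by
  have hi : Integrable (fun x => ‖g x‖ ^ 2) :=
    (hg.norm.pow 2).integrable_of_hasCompactSupport (hc.norm.comp_left (zero_pow two_ne_zero))
  have h : ∀ x, ‖g x‖ₑ ^ 2 = ‖(‖g x‖ ^ 2)‖ₑ := fun x => by
    rw [← ofReal_norm, ← ENNReal.ofReal_pow (norm_nonneg _), Real.enorm_eq_ofReal (sq_nonneg _)]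
  simp_rw [h]
  exact hi.2

/-! ## The gradient of the family `U_{a,b} = a • U(b •)` -/

/-- `∇U_{a,b}(x) = (a b) • ∇U(b x)` (tree `fderiv_const_smul_comp_smul'`). [folklore] -/
theorem fderiv_fam (a b : ℝ) (x : E3) :
    fderiv ℝ (fam a b) x = (a * b) • fderiv ℝ testDatum (b • x) :=
  fderiv_const_smul_comp_smul' testDatum a b x

/-- `∇U_{a,b}` is continuous. [folklore] -/
theorem continuous_fderiv_fam (a b : ℝ) : Continuous (fderiv ℝ (fam a b)) :=
  (contDiff_fam a b).continuous_fderiv (by simp)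

/-- `∇U_{a,b}` has compact support (`b ≠ 0`). [folklore] -/
theorem hasCompactSupport_fderiv_fam (a : ℝ) {b : ℝ} (hb : b ≠ 0) :
    HasCompactSupport (fderiv ℝ (fam a b)) :=
  (hasCompactSupport_fam a hb).fderiv (𝕜 := ℝ)

/-- `‖∇U_{a,b}‖²_{L²} = a² b⁻¹ ‖∇U‖²_{L²}` (`b > 0`; `dim = 3`). [folklore] -/
theorem l2Sq_fderiv_fam (a : ℝ) {b : ℝ} (hb : 0 < b) :
    l2Sq (fderiv ℝ (fam a b)) = a ^ 2 * b⁻¹ * ∫ x, ‖fderiv ℝ testDatum x‖ ^ 2 := by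
  rw [l2Sq_eq_integral' (continuous_fderiv_fam a b)]
  have h1 : (fun y => ‖fderiv ℝ (fam a b) y‖ ^ 2) =
      fun y => (a * b) ^ 2 * (fun x => ‖fderiv ℝ testDatum x‖ ^ 2) (b • y) := by
    funext y
    rw [fderiv_fam, norm_smul, mul_pow, Real.norm_eq_abs, sq_abs]
  rw [h1, integral_const_mul, Measure.integral_comp_smul_of_nonneg volume
    (fun x => ‖fderiv ℝ testDatum x‖ ^ 2) b (hR := hb.le), finrank_euclideanSpace_fin, smul_eq_mul]
  have hb3 : b ^ 3 ≠ 0 := pow_ne_zero 3 hb.ne'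
  field_simp

/-- The base field's gradient has positive `L²` mass (`∇U ≢ 0`, landed `exists_fderiv_testDatum_ne_zero`).
[folklore] -/
theorem integral_sq_fderiv_testDatum_pos : 0 < ∫ x, ‖fderiv ℝ testDatum x‖ ^ 2 := by
  obtain ⟨x₀, hx₀⟩ := exists_fderiv_testDatum_ne_zero
  have hc : Continuous (fderiv ℝ testDatum) := contDiff_testDatum.continuous_fderiv (by simp)
  have hs : HasCompactSupport (fderiv ℝ testDatum) := hasCompactSupport_testDatum.fderiv (𝕜 := ℝ)
  exact integral_pos_of_integrable_nonneg_nonzero (hc.norm.pow 2)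
    ((hc.norm.pow 2).integrable_of_hasCompactSupport (hs.norm.comp_left (zero_pow two_ne_zero)))
    (fun x => sq_nonneg _) (pow_ne_zero 2 (norm_ne_zero_iff.2 hx₀))

/-- `‖U_{1,b}‖²_{H¹} = b⁻³‖U‖²_{L²} + b⁻¹‖∇U‖²_{L²}` (`b > 0`). [folklore] -/
theorem h1Sq_fam_one {b : ℝ} (hb : 0 < b) :
    h1Sq (fam 1 b) = (b ^ 3)⁻¹ * (∫ x, ‖testDatum x‖ ^ 2) + b⁻¹ * ∫ x, ‖fderiv ℝ testDatum x‖ ^ 2 := by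
  unfold h1Sq
  rw [l2Sq_fam 1 hb, l2Sq_fderiv_fam 1 hb]
  ring

/-! ## The refutation -/

/-- **`Step7_BGW510 K` is false for every `K`** ((5.10) p.9 l.44–58): test the display on the
concentrated field `U_{1,b} = U(b·)` at the point `b⁻¹x₀` where `|U(x₀)| > 0`. With
`A = ‖U‖², D = ‖∇U‖² > 0, C = ‖ΔU‖²`: `h1Sq U_{1,b} = b⁻³A + b⁻¹D ∈ [b⁻¹D, b⁻¹(A+D)]` and
`stokesSq U_{1,b} = bC`, so the logarithm's argument is `≤ e + 1 + b√(C/D)` and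
`log ≤ 2√((e+1+√(C/D))·b)`; squaring the display gives `|U(x₀)|² ≤ C_BGW²·(A+D)·2√(e+1+√(C/D))·b^{-1/2}`,
false for `b` large. [cite: Zeroual2026, (5.10)–(5.11) p.9 l.44–58] -/
theorem not_Step7_BGW510 (K : Constants) : ¬ Step7_BGW510 K := by
  intro h
  obtain ⟨x₀, hx₀⟩ := Function.ne_iff.1 testDatum_ne_zero
  obtain ⟨m, hm_def⟩ : ∃ m : ℝ, m = ‖testDatum x₀‖ := ⟨_, rfl⟩
  have hm : 0 < m := by rw [hm_def]; exact norm_pos_iff.2 hx₀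
  obtain ⟨A, hA_def⟩ : ∃ A : ℝ, A = ∫ x, ‖testDatum x‖ ^ 2 := ⟨_, rfl⟩
  obtain ⟨D, hD_def⟩ : ∃ D : ℝ, D = ∫ x, ‖fderiv ℝ testDatum x‖ ^ 2 := ⟨_, rfl⟩
  obtain ⟨C, hC_def⟩ : ∃ C : ℝ, C = ∫ x, ‖(Δ testDatum) x‖ ^ 2 := ⟨_, rfl⟩
  have hA : 0 < A := by rw [hA_def]; exact integral_sq_testDatum_pos
  have hD : 0 < D := by rw [hD_def]; exact integral_sq_fderiv_testDatum_pos
  have hC : 0 ≤ C := by rw [hC_def]; exact integral_nonneg fun _ => sq_nonneg _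
  obtain ⟨s, hs_def⟩ : ∃ s : ℝ, s = Real.sqrt (C / D) := ⟨_, rfl⟩
  have hs : 0 ≤ s := by rw [hs_def]; exact Real.sqrt_nonneg _
  obtain ⟨E₁, hE₁_def⟩ : ∃ E₁ : ℝ, E₁ = Real.exp 1 + 1 + s := ⟨_, rfl⟩
  have hE₁ : 0 < E₁ := by rw [hE₁_def]; linarith [Real.exp_pos 1]
  obtain ⟨M₀, hM₀_def⟩ : ∃ M₀ : ℝ, M₀ = K.CBGW ^ 2 * ((A + D) * (2 * Real.sqrt E₁)) := ⟨_, rfl⟩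
  have hM₀ : 0 ≤ M₀ := by
    rw [hM₀_def]
    exact mul_nonneg (sq_nonneg _) (mul_nonneg (by linarith) (mul_nonneg two_pos.le (Real.sqrt_nonneg _)))
  -- the concentration rate `b = (M₀/m² + 1)²`
  have hq : 0 ≤ M₀ / m ^ 2 := div_nonneg hM₀ (sq_nonneg _)
  obtain ⟨b, hb_def⟩ : ∃ b : ℝ, b = (M₀ / m ^ 2 + 1) ^ 2 := ⟨_, rfl⟩
  have hsb : Real.sqrt b = M₀ / m ^ 2 + 1 := by
    rw [hb_def, Real.sqrt_sq (by linarith)]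
  have hb1 : 1 ≤ b := by
    have h1 : (1:ℝ) ≤ M₀ / m ^ 2 + 1 := by linarith
    rw [hb_def]
    calc (1:ℝ) = 1 ^ 2 := by norm_num
      _ ≤ (M₀ / m ^ 2 + 1) ^ 2 := pow_le_pow_left₀ zero_le_one h1 2
  have hb : 0 < b := lt_of_lt_of_le one_pos hb1
  have hb3 : (b ^ 3)⁻¹ ≤ b⁻¹ := by
    apply inv_anti₀ hb
    calc b = b * 1 * 1 := by ring
      _ ≤ b * b * b := by gcongr
      _ = b ^ 3 := by ring
  -- the norms of `U_{1,b}`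
  obtain ⟨H, hH_def⟩ : ∃ H : ℝ, H = h1Sq (fam 1 b) := ⟨_, rfl⟩
  obtain ⟨S, hS_def⟩ : ∃ S : ℝ, S = stokesSq (fam 1 b) := ⟨_, rfl⟩
  have hHeq : H = (b ^ 3)⁻¹ * A + b⁻¹ * D := by
    rw [hH_def, hA_def, hD_def]; exact h1Sq_fam_one hb
  have hSeq : S = b * C := by
    rw [hS_def, hC_def, stokesSq_fam 1 hb]; ring
  have hS0 : 0 ≤ S := by rw [hSeq]; exact mul_nonneg hb.le hC
  have hHlo : b⁻¹ * D ≤ H := by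
    rw [hHeq]
    have : 0 ≤ (b ^ 3)⁻¹ * A := mul_nonneg (inv_nonneg.2 (pow_pos hb 3).le) hA.le
    linarith
  have hHpos : 0 < H := lt_of_lt_of_le (mul_pos (inv_pos.2 hb) hD) hHlo
  have hHhi : H ≤ b⁻¹ * (A + D) := by
    rw [hHeq]
    have : (b ^ 3)⁻¹ * A ≤ b⁻¹ * A := mul_le_mul_of_nonneg_right hb3 hA.le
    linarith
  -- the display on `U_{1,b}` at `b⁻¹ • x₀`
  have hdisp := h (fam 1 b) ((contDiff_fam 1 b).of_le (by norm_cast))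
    (lintegral_enorm_sq_lt_top (contDiff_fam 1 b).continuous (hasCompactSupport_fam 1 hb.ne'))
    (lintegral_enorm_sq_lt_top' (continuous_fderiv_fam 1 b) (hasCompactSupport_fderiv_fam 1 hb.ne'))
    (lintegral_enorm_sq_lt_top (continuous_laplacian_fam 1 b) (hasCompactSupport_laplacian_fam 1 hb.ne'))
    (hH_def ▸ hHpos)
    ((contDiff_fam 1 b).continuous.bounded_above_of_compact_support (hasCompactSupport_fam 1 hb.ne'))
    (b⁻¹ • x₀)
  have hval : fam 1 b (b⁻¹ • x₀) = testDatum x₀ := by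
    simp [fam, smul_smul, mul_inv_cancel₀ hb.ne']
  rw [hval, ← hm_def, ← hH_def, ← hS_def] at hdisp
  obtain ⟨L, hL_def⟩ : ∃ L : ℝ, L = Real.log (Real.exp 1 + Real.sqrt (H + S) / Real.sqrt H) := ⟨_, rfl⟩
  rw [← hL_def] at hdisp
  -- the logarithm's argument: `√(H+S)/√H ≤ 1 + b s`
  have hratio : Real.sqrt (H + S) / Real.sqrt H ≤ 1 + b * s := by
    have hsH : 0 < Real.sqrt H := Real.sqrt_pos.2 hHpos
    rw [div_le_iff₀ hsH]
    have hbs : S ≤ (b * s) ^ 2 * H := by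
      have hs2 : s ^ 2 = C / D := by rw [hs_def]; exact Real.sq_sqrt (div_nonneg hC hD.le)
      have heq : (b * s) ^ 2 * (b⁻¹ * D) = b * C := by
        rw [mul_pow, hs2]; field_simp
      calc S = (b * s) ^ 2 * (b⁻¹ * D) := by rw [heq, hSeq]
        _ ≤ (b * s) ^ 2 * H := mul_le_mul_of_nonneg_left hHlo (sq_nonneg _)
    have h1 : H + S ≤ (1 + b * s) ^ 2 * H := by
      have hnn : 0 ≤ b * s * H := mul_nonneg (mul_nonneg hb.le hs) hHpos.le
      have hexp : (1 + b * s) ^ 2 * H = H + 2 * (b * s * H) + (b * s) ^ 2 * H := by ring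
      rw [hexp]
      linarith [hbs]
    calc Real.sqrt (H + S) ≤ Real.sqrt ((1 + b * s) ^ 2 * H) := Real.sqrt_le_sqrt h1
      _ = (1 + b * s) * Real.sqrt H := by
          rw [Real.sqrt_mul (sq_nonneg _), Real.sqrt_sq (by linarith [mul_nonneg hb.le hs])]
  have hr0 : 0 ≤ Real.sqrt (H + S) / Real.sqrt H :=
    div_nonneg (Real.sqrt_nonneg _) (Real.sqrt_nonneg _)
  have hL0 : 0 ≤ L := by
    rw [hL_def]
    apply Real.log_nonneg
    linarith [Real.add_one_le_exp (1:ℝ)]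
  have hLhi : L ≤ 2 * Real.sqrt E₁ * Real.sqrt b := by
    have harg : 0 < Real.exp 1 + Real.sqrt (H + S) / Real.sqrt H := by
      linarith [Real.exp_pos 1]
    have h1 : L ≤ Real.log (Real.exp 1 + 1 + b * s) := by
      rw [hL_def]; exact Real.log_le_log harg (by linarith)
    have h2 : Real.log (Real.exp 1 + 1 + b * s) ≤ 2 * Real.sqrt (Real.exp 1 + 1 + b * s) := by
      -- `log x ≤ x^{1/2} / (1/2)` (Mathlib `Real.log_le_rpow_div`; cf. the landed `DFI1995.log_le_two_mul_sqrt`)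
      have hx : 0 ≤ Real.exp 1 + 1 + b * s := by linarith [Real.exp_pos 1, mul_nonneg hb.le hs]
      have h := Real.log_le_rpow_div hx (by norm_num : (0:ℝ) < 1 / 2)
      rw [Real.sqrt_eq_rpow]
      linarith
    have h3 : Real.exp 1 + 1 + b * s ≤ E₁ * b := by
      rw [hE₁_def]
      have he : 0 ≤ Real.exp 1 + 1 := by linarith [Real.exp_pos 1]
      have h4 : (Real.exp 1 + 1) * 1 ≤ (Real.exp 1 + 1) * b := mul_le_mul_of_nonneg_left hb1 he
      have hexp : (Real.exp 1 + 1 + s) * b = (Real.exp 1 + 1) * b + b * s := by ring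
      rw [hexp]
      linarith
    calc L ≤ 2 * Real.sqrt (Real.exp 1 + 1 + b * s) := h1.trans h2
      _ ≤ 2 * Real.sqrt (E₁ * b) := by gcongr
      _ = 2 * Real.sqrt E₁ * Real.sqrt b := by rw [Real.sqrt_mul hE₁.le, mul_assoc]
  -- square the display
  have hsq : m ^ 2 ≤ K.CBGW ^ 2 * (H * L) := by
    have h1 : m ^ 2 ≤ (K.CBGW * Real.sqrt H * Real.sqrt L) ^ 2 := pow_le_pow_left₀ hm.le hdisp 2
    calc m ^ 2 ≤ (K.CBGW * Real.sqrt H * Real.sqrt L) ^ 2 := h1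
      _ = K.CBGW ^ 2 * (Real.sqrt H ^ 2 * Real.sqrt L ^ 2) := by ring
      _ = K.CBGW ^ 2 * (H * L) := by rw [Real.sq_sqrt hHpos.le, Real.sq_sqrt hL0]
  have hsbb : Real.sqrt b / b = (Real.sqrt b)⁻¹ := by
    have h1 : Real.sqrt b * Real.sqrt b = b := Real.mul_self_sqrt hb.le
    have h2 : 0 < Real.sqrt b := Real.sqrt_pos.2 hb
    field_simp
    linarith [h1]
  have hHL : H * L ≤ (A + D) * (2 * Real.sqrt E₁) * (Real.sqrt b)⁻¹ := by
    calc H * L ≤ (b⁻¹ * (A + D)) * (2 * Real.sqrt E₁ * Real.sqrt b) :=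
          mul_le_mul hHhi hLhi hL0 (mul_nonneg (inv_nonneg.2 hb.le) (by linarith))
      _ = (A + D) * (2 * Real.sqrt E₁) * (Real.sqrt b / b) := by ring
      _ = (A + D) * (2 * Real.sqrt E₁) * (Real.sqrt b)⁻¹ := by rw [hsbb]
  have hfin : m ^ 2 ≤ M₀ * (Real.sqrt b)⁻¹ := by
    calc m ^ 2 ≤ K.CBGW ^ 2 * (H * L) := hsq
      _ ≤ K.CBGW ^ 2 * ((A + D) * (2 * Real.sqrt E₁) * (Real.sqrt b)⁻¹) :=
          mul_le_mul_of_nonneg_left hHL (sq_nonneg _)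
      _ = M₀ * (Real.sqrt b)⁻¹ := by rw [hM₀_def]; ring
  -- but `M₀ / √b < m²` by the choice of `b`
  have hlt : M₀ * (Real.sqrt b)⁻¹ < m ^ 2 := by
    have hm2 : 0 < m ^ 2 := pow_pos hm 2
    have hpos : 0 < M₀ / m ^ 2 + 1 := by linarith
    rw [hsb, ← div_eq_mul_inv, div_lt_iff₀ hpos]
    have : m ^ 2 * (M₀ / m ^ 2 + 1) = M₀ + m ^ 2 := by field_simp
    rw [this]; linarith
  exact absurd (hfin.trans_lt hlt) (lt_irrefl _)

end Summit.NavierStokesRegularity.NavierStokesRegularity.Theorems.Zeroual2026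

end
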